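import Summits.ABC.StewartYu.GenThreeVanishing
import Literature.NumberTheory.Transcendental.PhilipponZeroEstimateMultidegree
import HarnessLib

/-!
# Gen-3 engines ⇒ the zero estimate, II: the points `θ^x`, their sumsets, and the HEADLINE

`Summits/ABC/StewartYu/GenThreeVanishingPoints.lean` — cell `abc-stewartyu` (rung F-A1 = Stewart–Yu 2001,
route `PadicPrimesKummerThird`, cruxes `Y07Odd` stmt-ABC-19658 / `Y07Two` stmt-ABC-19659), seat p3 (g4).
Theorems only; companion of `GenThreeVanishing.lean` (§A generic index-words ⇒ `GaGm.VanishesToOrder`,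
§B the Baker–Wüstholz letters).

* §C (points): `Σ_X = {θ^x : |x| ≤ X}`, `θ = (c, ξ) ∈ 𝔾ₐ × 𝔾ₘ^m`, contains `e`, is finite,
  `Σ_X[d] ⊆ Σ_{dX}`, and monomials evaluate explicitly at `θ^x` (`evalAt_monomial_zpow`);
* §D HEADLINE `vanishesToOrder_sumset_of_engineIdentities` (and its `Nesterenko2003_prop51`-shaped
  twin `prop51_vanishing_of_engineIdentities`): the engine's scalar identities (Nesterenko 2003 (5.4)
  unfolded: `∂₀^t ∏ₖ ∂ₖ^{μₖ} Q (θ^x) = 0`) for `|x| ≤ (m+1)X`, `t + ∑ μₖ ≤ T` imply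
  `∀ g ∈ GaGm.sumset Σ_X (m+1), GaGm.VanishesToOrder Q W g (T+1)` for every `W` on which `∑ bⱼηⱼ = 0`
  — verbatim the vanishing hypothesis of `Literature.NumberTheory.Transcendental.Nesterenko2003_prop51`
  (presented form `vanishesToOrder_sumset_of_presentedIdentities`: `Q = ∑_{i∈I} qᵢ Y^{sᵢ}`);
* §E `exists_obstruction_of_presentedIdentities`: composition with the named fact (as a hypothesis
  `hZ : Nesterenko2003_prop51`, exactly as the registered stubs take it): identities + `Q ≠ 0` +
  degree bounds ⇒ the obstruction subgroup `G* = 𝔙 × T_Φ` with Nesterenko's inequality — the input of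
  the Matveev alternative (the engine's END / `NesterenkoZeroEnd`).

WHAT THIS IS NOT: not the zero estimate (p5), not its consumer (p4's `NesterenkoZeroEnd`), not an engine.

References: Yu. V. Nesterenko, *Linear forms in logarithms of rational numbers*, LNM 1819 (2003), §5
pp. 89–92 ((5.2)–(5.4), Prop. 5.1, "thanks to (5.4)").
-/

noncomputable section

open MvPolynomial Finset
open Literature.NumberTheory.Transcendental
open Literature.NumberTheory.Transcendental.GaGm

namespace Summit.ABC.StewartYu.GenThreeVanishing

/-! ## §C. The points `θ^x` and their sumsets -/

section Points

variable {m : ℕ}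

/-- `a^{∑ fᵢ} = ∏ a^{fᵢ}` in a commutative group. [folklore] -/
theorem zpow_finset_sum {G : Type*} [CommGroup G] (a : G) {ι : Type*} (s : Finset ι) (f : ι → ℤ) :
    a ^ (∑ i ∈ s, f i) = ∏ i ∈ s, a ^ f i := by
  classical
  induction s using Finset.induction_on with
  | empty => simp
  | insert i s hi ih => rw [Finset.sum_insert hi, Finset.prod_insert hi, zpow_add, ih]

/-- `e = θ⁰` lies in `Σ_X = {θ^x : |x| ≤ X}`. [folklore] -/
theorem one_mem_zpowSet (θ : GaGm m) (X : ℕ) :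
    (1 : GaGm m) ∈ {g : GaGm m | ∃ x : ℤ, |x| ≤ (X : ℤ) ∧ g = θ ^ x} :=
  ⟨0, by simp, (zpow_zero θ).symm⟩

/-- `Σ_X = {θ^x : |x| ≤ X}` is finite. [folklore] -/
theorem finite_zpowSet (θ : GaGm m) (X : ℕ) :
    {g : GaGm m | ∃ x : ℤ, |x| ≤ (X : ℤ) ∧ g = θ ^ x}.Finite := by
  classical
  refine Set.Finite.subset ((Finset.Icc (-(X : ℤ)) X).image fun x => θ ^ x).finite_toSet ?_
  rintro g ⟨x, hx, rfl⟩
  simp only [Finset.coe_image, Finset.coe_Icc, Set.mem_image, Set.mem_Icc]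
  exact ⟨x, abs_le.mp hx, rfl⟩

/-- Sumsets of `Σ_X`: `Σ_X[d] ⊆ Σ_{dX}` (`θ^{x₁} ⋯ θ^{x_d} = θ^{x₁ + ⋯ + x_d}`). [folklore] -/
theorem exists_zpow_of_mem_sumset (θ : GaGm m) (X d : ℕ) {g : GaGm m}
    (hg : g ∈ sumset {g : GaGm m | ∃ x : ℤ, |x| ≤ (X : ℤ) ∧ g = θ ^ x} d) :
    ∃ x : ℤ, |x| ≤ ((d * X : ℕ) : ℤ) ∧ g = θ ^ x := by
  obtain ⟨σ, hσ, rfl⟩ := hg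
  choose x hx hσx using hσ
  refine ⟨∑ i, x i, ?_, ?_⟩
  · calc |∑ i, x i| ≤ ∑ i, |x i| := Finset.abs_sum_le_sum_abs _ _
      _ ≤ ∑ _i : Fin d, (X : ℤ) := Finset.sum_le_sum fun i _ => hx i
      _ = ((d * X : ℕ) : ℤ) := by simp
  · rw [zpow_finset_sum]
    exact Finset.prod_congr rfl fun i _ => hσx i

/-- Coordinates of `θ^x` for `θ = (c, ξ)`: `Y₀ = x·c`. [folklore] -/
theorem coord_zpow_zero (c : ℂ) (ξ : Fin m → ℂˣ) (x : ℤ) :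
    coord (((Multiplicative.ofAdd c, ξ) : GaGm m) ^ x) 0 = (x : ℂ) * c := by
  rw [coord_zero]
  show Multiplicative.toAdd ((Multiplicative.ofAdd c) ^ x) = _
  rw [toAdd_zpow, toAdd_ofAdd, zsmul_eq_mul]

/-- Coordinates of `θ^x` for `θ = (c, ξ)`: `Yⱼ = ξⱼ^x`. [folklore] -/
theorem coord_zpow_succ (c : ℂ) (ξ : Fin m → ℂˣ) (x : ℤ) (j : Fin m) :
    coord (((Multiplicative.ofAdd c, ξ) : GaGm m) ^ x) j.succ = (ξ j : ℂ) ^ x := by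
  rw [coord_succ]
  show (((ξ ^ x) j : ℂˣ) : ℂ) = _
  rw [show (ξ ^ x) j = ξ j ^ x from rfl, Units.val_zpow_eq_zpow_val]

/-- Value of a monomial at `θ^x`, `θ = (c, ξ)`:
`(r Y^s)(θ^x) = r (xc)^{s₀} ∏ⱼ (ξⱼ^x)^{s_{j+1}}`. [folklore] -/
theorem evalAt_monomial_zpow (c : ℂ) (ξ : Fin m → ℂˣ) (x : ℤ) (s : Fin (m + 1) →₀ ℕ) (r : ℂ) :
    evalAt (monomial s r) (((Multiplicative.ofAdd c, ξ) : GaGm m) ^ x) =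
      r * ((x : ℂ) * c) ^ (s 0) * ∏ j, ((ξ j : ℂ) ^ x) ^ (s j.succ) := by
  rw [evalAt, eval_monomial, Finsupp.prod_fintype _ _ (fun i => pow_zero _), Fin.prod_univ_succ,
    coord_zpow_zero, mul_assoc]
  congr 2
  exact Finset.prod_congr rfl fun j _ => by rw [coord_zpow_succ]

end Points

/-! ## §D. The headline: engine identities ⇒ the vanishing hypothesis of `Nesterenko2003_prop51` -/

section Headline

variable {m : ℕ} (b : Fin m → ℂ) (j₀ : Fin m)
variable (L : Fin (m + 1) → ℂ × (Fin m → ℂ))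

/-- Counting the letters of an index-word: `#{e₀-letters} + ∑ₖ #{letters k.succ} = length`. [folklore] -/
theorem card_letters_eq_length {k : ℕ} (σ : Fin k → Fin (m + 1)) :
    (Finset.univ.filter fun i => σ i = 0).card +
        ∑ k' : Fin m, (Finset.univ.filter fun i => σ i = k'.succ).card = k := by
  classical
  have h := Finset.card_eq_sum_card_fiberwise (f := σ) (s := Finset.univ) (t := Finset.univ)
    (fun _ _ => Finset.mem_univ _)
  rw [Finset.card_univ, Fintype.card_fin, Fin.sum_univ_succ] at h
  exact h.symm

/-- Grouping the scalars of an index-word by letter: the `e₀`-letters contribute `1`, each letter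
`k.succ` its scalar, so the product is `∏ₖ scalₖ^{#letters k.succ}`. [folklore] -/
theorem prod_letterScalars_eq {k : ℕ} (σ : Fin k → Fin (m + 1)) (f : Fin m → ℂ) :
    (∏ i, Fin.cases (motive := fun _ => ℂ) 1 f (σ i)) =
      ∏ k' : Fin m, f k' ^ (Finset.univ.filter fun i => σ i = k'.succ).card := by
  classical
  rw [← Finset.prod_fiberwise' Finset.univ σ (fun v => Fin.cases (motive := fun _ => ℂ) 1 f v),
    Fin.prod_univ_succ]
  simp only [Finset.prod_const, Fin.cases_zero, one_pow, one_mul, Fin.cases_succ]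

/-- **Evaluation of an index-word in the Baker–Wüstholz letters at `θ^x`** (`θ = (c, ξ)`), for a
polynomial PRESENTED as a finite sum of monomials `Q = ∑_{i ∈ I} qᵢ Y^{sᵢ}` (repetitions allowed):
with `t = #{e₀-letters}`,
`(𝔇_σ Q)(θ^x) = ∑ᵢ qᵢ · sᵢ₀(sᵢ₀−1)⋯(sᵢ₀−t+1) · (xc)^{sᵢ₀−t} · ∏_{letters} scal(sᵢ) · ∏ⱼ (ξⱼ^x)^{sᵢ,j+1}`.
[cite: Nesterenko2003, §5 (5.2)–(5.4)] -/
theorem evalAt_wordDeriv_bwLetters_sum (hL0 : L 0 = (1, 0))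
    (hLs : ∀ k : Fin m, L k.succ = (0, Pi.single k (b j₀) - Pi.single j₀ (b k)))
    (c : ℂ) (ξ : Fin m → ℂˣ) {ι : Type*} (I : Finset ι) (s : ι → (Fin (m + 1) →₀ ℕ)) (q : ι → ℂ)
    (Q : MvPolynomial (Fin (m + 1)) ℂ) (hQ : Q = ∑ i ∈ I, monomial (s i) (q i)) (x : ℤ)
    {k : ℕ} (σ : Fin k → Fin (m + 1)) :
    evalAt (wordDeriv (L ∘ σ) Q) (((Multiplicative.ofAdd c, ξ) : GaGm m) ^ x) =
      ∑ i ∈ I, q i *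
        ((((s i) 0).descFactorial (Finset.univ.filter fun l => σ l = 0).card : ℕ) : ℂ) *
        ((x : ℂ) * c) ^ ((s i) 0 - (Finset.univ.filter fun l => σ l = 0).card) *
        (∏ l, Fin.cases (motive := fun _ => ℂ) 1
            (fun k' => b j₀ * (((s i) k'.succ : ℕ) : ℂ) - b k' * (((s i) j₀.succ : ℕ) : ℂ)) (σ l)) *
        ∏ j, ((ξ j : ℂ) ^ x) ^ ((s i) j.succ) := by
  classical
  rw [hQ, wordDeriv_sum, evalAt_sum]
  refine Finset.sum_congr rfl fun i _ => ?_
  rw [wordDeriv_bwLetters_monomial b j₀ L hL0 hLs k σ (s i) (q i), evalAt_smul,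
    iterate_pderiv_zero_monomial, evalAt_monomial_zpow]
  have e0 : (s i - Finsupp.single (0 : Fin (m + 1)) (Finset.univ.filter fun l => σ l = 0).card) 0 =
      (s i) 0 - (Finset.univ.filter fun l => σ l = 0).card := by
    rw [Finsupp.tsub_apply, Finsupp.single_eq_same]
  have es : ∀ j : Fin m,
      (s i - Finsupp.single (0 : Fin (m + 1)) (Finset.univ.filter fun l => σ l = 0).card) j.succ =
        (s i) j.succ := fun j => by
    rw [Finsupp.tsub_apply, Finsupp.single_eq_of_ne (Fin.succ_ne_zero j), tsub_zero]
  rw [e0]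
  simp only [es]
  ring

/-- **HEADLINE (presented form) — the engine's identities give the vanishing hypothesis of the zero
estimate.**  Data: `b` with pivot `b_{j₀} ≠ 0`; any subspace `W` on which `∑ bⱼηⱼ = 0` (Nesterenko's
`𝔚`, or a subspace of it); the point `θ = (c, ξ) ∈ G = 𝔾ₐ × 𝔾ₘ^m`; the (shifted, honest) polynomial
`Q` PRESENTED as `∑_{i ∈ I} qᵢ Y^{sᵢ}`; ranges `X`, `T`.  Hypothesis (`hId`) = the identities (5.4)
UNFOLDED: for all integers `|x| ≤ (m+1)X` and all `(t, μ)` with `μ_{j₀} = 0`, `t + ∑ μₖ ≤ T`,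
`∑ᵢ qᵢ · sᵢ₀!/(sᵢ₀−t)! · (xc)^{sᵢ₀−t} · ∏ₖ (b_{j₀}sᵢ,ₖ₊₁ − bₖsᵢ,ⱼ₀₊₁)^{μₖ} · ∏ⱼ (ξⱼ^x)^{sᵢ,j+1} = 0`
(i.e. `∂₀^t ∏ₖ ∂ₖ^{μₖ} Q (θ^x) = 0`).  Conclusion: `Q` vanishes to order `≥ T + 1` along `exp_G(W)` at
every point of `Σ_X[m+1]` — verbatim the vanishing hypothesis of
`Literature.NumberTheory.Transcendental.Nesterenko2003_prop51` (with its `S := Σ_X`, `n := m`,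
`(n+1)S₀ + 1 := T + 1`). [cite: Nesterenko2003, §5.2 p. 99 ("thanks to (5.4)")] -/
theorem vanishesToOrder_sumset_of_presentedIdentities (hb : b j₀ ≠ 0)
    (W : Submodule ℂ (ℂ × (Fin m → ℂ))) (hWb : ∀ u ∈ W, ∑ j, b j * u.2 j = 0)
    (c : ℂ) (ξ : Fin m → ℂˣ) {ι : Type*} (I : Finset ι) (s : ι → (Fin (m + 1) →₀ ℕ)) (q : ι → ℂ)
    (Q : MvPolynomial (Fin (m + 1)) ℂ) (hQ : Q = ∑ i ∈ I, monomial (s i) (q i)) (X T : ℕ)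
    (hId : ∀ x : ℤ, |x| ≤ (((m + 1) * X : ℕ) : ℤ) → ∀ (t : ℕ) (μ : Fin m → ℕ), μ j₀ = 0 →
      t + ∑ k, μ k ≤ T →
      ∑ i ∈ I, q i * ((((s i) 0).descFactorial t : ℕ) : ℂ) * ((x : ℂ) * c) ^ ((s i) 0 - t) *
        (∏ k, (b j₀ * (((s i) k.succ : ℕ) : ℂ) - b k * (((s i) j₀.succ : ℕ) : ℂ)) ^ μ k) *
        ∏ j, ((ξ j : ℂ) ^ x) ^ ((s i) j.succ) = 0) :
    ∀ g ∈ sumset {g : GaGm m | ∃ x : ℤ, |x| ≤ (X : ℤ) ∧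
        g = ((Multiplicative.ofAdd c, ξ) : GaGm m) ^ x} (m + 1),
      VanishesToOrder Q W g (T + 1) := by
  classical
  -- the letters
  set L : Fin (m + 1) → ℂ × (Fin m → ℂ) :=
    Fin.cases ((1 : ℂ), (0 : Fin m → ℂ)) fun k => ((0 : ℂ), Pi.single k (b j₀) - Pi.single j₀ (b k))
    with hLdef
  have hL0 : L 0 = (1, 0) := by simp [hLdef]
  have hLs : ∀ k : Fin m, L k.succ = (0, Pi.single k (b j₀) - Pi.single j₀ (b k)) := fun k => by
    simp [hLdef]
  intro g hg
  obtain ⟨x, hx, rfl⟩ := exists_zpow_of_mem_sumset _ X (m + 1) hg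
  refine vanishesToOrder_of_indexWords L W (le_span_bwLetters b j₀ L hb hL0 hLs W hWb) Q _ (T + 1) ?_
  intro k hk σ
  rw [evalAt_wordDeriv_bwLetters_sum b j₀ L hL0 hLs c ξ I s q Q hQ x σ]
  by_cases hdeg : ∃ l, σ l = j₀.succ
  · -- a degenerate letter `j₀.succ` occurs: its scalar vanishes, so does every summand
    obtain ⟨l, hl⟩ := hdeg
    refine Finset.sum_eq_zero fun i _ => ?_
    have hzero : (∏ l, Fin.cases (motive := fun _ => ℂ) 1
        (fun k' => b j₀ * (((s i) k'.succ : ℕ) : ℂ) - b k' * (((s i) j₀.succ : ℕ) : ℂ)) (σ l)) = 0 :=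
      Finset.prod_eq_zero (Finset.mem_univ l) (by rw [hl, Fin.cases_succ, sub_self])
    rw [hzero, mul_zero, zero_mul]
  · have hμ0 : (Finset.univ.filter fun l => σ l = j₀.succ).card = 0 := by
      rw [Finset.card_eq_zero, Finset.filter_eq_empty_iff]
      exact fun l _ hl => hdeg ⟨l, hl⟩
    have h := hId x hx (Finset.univ.filter fun l => σ l = 0).card
      (fun k' => (Finset.univ.filter fun l => σ l = k'.succ).card) hμ0
      (by rw [card_letters_eq_length]; omega)
    rw [← h]
    refine Finset.sum_congr rfl fun i _ => ?_
    rw [prod_letterScalars_eq]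

/-- **HEADLINE (support form)**: the same with `Q` presented by its own support,
`Q = ∑_{s ∈ supp Q} (coeff s Q) Y^s`. [cite: Nesterenko2003, §5.2 p. 99] -/
theorem vanishesToOrder_sumset_of_engineIdentities (hb : b j₀ ≠ 0)
    (W : Submodule ℂ (ℂ × (Fin m → ℂ))) (hWb : ∀ u ∈ W, ∑ j, b j * u.2 j = 0)
    (c : ℂ) (ξ : Fin m → ℂˣ) (Q : MvPolynomial (Fin (m + 1)) ℂ) (X T : ℕ)
    (hId : ∀ x : ℤ, |x| ≤ (((m + 1) * X : ℕ) : ℤ) → ∀ (t : ℕ) (μ : Fin m → ℕ), μ j₀ = 0 →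
      t + ∑ k, μ k ≤ T →
      ∑ s ∈ Q.support, Q.coeff s * (((s 0).descFactorial t : ℕ) : ℂ) * ((x : ℂ) * c) ^ (s 0 - t) *
        (∏ k, (b j₀ * ((s k.succ : ℕ) : ℂ) - b k * ((s j₀.succ : ℕ) : ℂ)) ^ μ k) *
        ∏ j, ((ξ j : ℂ) ^ x) ^ (s j.succ) = 0) :
    ∀ g ∈ sumset {g : GaGm m | ∃ x : ℤ, |x| ≤ (X : ℤ) ∧
        g = ((Multiplicative.ofAdd c, ξ) : GaGm m) ^ x} (m + 1),
      VanishesToOrder Q W g (T + 1) :=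
  vanishesToOrder_sumset_of_presentedIdentities b j₀ hb W hWb c ξ Q.support (fun s => s)
    (fun s => Q.coeff s) Q Q.as_sum X T hId

end Headline

/-! ## §E. Applying the zero estimate: the obstruction subgroup handed to the engine's END

Composition with the named fact `Nesterenko2003_prop51` (taken as a hypothesis `hZ`, exactly as the
registered stubs `stub_engineOdd` / `stub_engineTwo` take it): from the engine's identities, `Q ≠ 0`
and the degree bounds, the zero estimate hands over the connected algebraic subgroup `G* = 𝔙 × T_Φ`
with its inequality — the input of the Matveev alternative (Nesterenko 2003 §5.2, Lemmas 5.2–5.4). -/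

section Apply

variable {m : ℕ} (b : Fin m → ℂ) (j₀ : Fin m)

/-- **Engine identities + `Nesterenko2003_prop51` ⇒ the obstruction subgroup** (Nesterenko 2003,
Prop. 5.1 applied as on p. 99): for `Q = ∑_{i ∈ I} qᵢ Y^{sᵢ} ≠ 0` of multidegree `≤ (D₀, 2D₁, …, 2Dₘ)`
satisfying the identities (5.4) for `|x| ≤ (m+1)X`, `t + ∑ μₖ ≤ (m+1)S₀`, there is a connected
algebraic subgroup `H = 𝔙 × T_Φ` of dimension `≤ m`, a basis `M` of `Φ`, with
`binom(S₀ + ℓ₀, ℓ₀) · Card((Σ_X·H)/H) · 𝓗(H; D₀, D) ≤ (m+1)! 2^m D₀ ∏ Dⱼ`.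
[cite: Nesterenko2003, Prop 5.1, §5.2] -/
theorem exists_obstruction_of_presentedIdentities (hZ : Nesterenko2003_prop51) (hb : b j₀ ≠ 0)
    (W : Submodule ℂ (ℂ × (Fin m → ℂ))) (hWb : ∀ u ∈ W, ∑ j, b j * u.2 j = 0)
    (c : ℂ) (ξ : Fin m → ℂˣ) {ι : Type*} (I : Finset ι) (s : ι → (Fin (m + 1) →₀ ℕ)) (q : ι → ℂ)
    (Q : MvPolynomial (Fin (m + 1)) ℂ) (hQ : Q = ∑ i ∈ I, monomial (s i) (q i)) (hQ0 : Q ≠ 0)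
    (D₀ S₀ X : ℕ) (D : Fin m → ℕ) (hdeg0 : Q.degreeOf 0 ≤ D₀)
    (hdeg : ∀ j : Fin m, Q.degreeOf j.succ ≤ 2 * D j)
    (hId : ∀ x : ℤ, |x| ≤ (((m + 1) * X : ℕ) : ℤ) → ∀ (t : ℕ) (μ : Fin m → ℕ), μ j₀ = 0 →
      t + ∑ k, μ k ≤ (m + 1) * S₀ →
      ∑ i ∈ I, q i * ((((s i) 0).descFactorial t : ℕ) : ℂ) * ((x : ℂ) * c) ^ ((s i) 0 - t) *
        (∏ k, (b j₀ * (((s i) k.succ : ℕ) : ℂ) - b k * (((s i) j₀.succ : ℕ) : ℂ)) ^ μ k) *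
        ∏ j, ((ξ j : ℂ) ^ x) ^ ((s i) j.succ) = 0) :
    ∃ (H : ConnAlgSubgroup m) (r : ℕ) (M : Matrix (Fin r) (Fin m) ℤ),
      LinearIndependent ℤ (fun i => M i) ∧
      H.chars = AddSubgroup.closure (Set.range fun i => M i) ∧
      H.addDim + (m - r) ≤ m ∧
      Nat.choose (S₀ + (Module.finrank ℂ W - Module.finrank ℂ ↥(W ⊓ H.tangent)))
          (Module.finrank ℂ W - Module.finrank ℂ ↥(W ⊓ H.tangent)) *
        Set.ncard ((QuotientGroup.mk : GaGm m → GaGm m ⧸ H.toSubgroup) ''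
          {g : GaGm m | ∃ x : ℤ, |x| ≤ (X : ℤ) ∧ g = ((Multiplicative.ofAdd c, ξ) : GaGm m) ^ x}) *
        nesterenkoH m r H.addDim M D₀ D ≤ (m + 1).factorial * 2 ^ m * D₀ * ∏ j, D j :=
  hZ m D₀ S₀ D W _ Q (finite_zpowSet _ X) (one_mem_zpowSet _ X) hQ0 hdeg0 hdeg
    (vanishesToOrder_sumset_of_presentedIdentities b j₀ hb W hWb c ξ I s q Q hQ X ((m + 1) * S₀) hId)

end Apply

end Summit.ABC.StewartYu.GenThreeVanishing

end
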